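/-
Copyright (c) 2026 the pub-hodgecm-mathlib formalisation cell (harness21).  Prover seat hodgecm-mathlib-LH4-p02 (g8): LH4-plan (g6) WORD #89∕#93 (P2h) ‹RANK-deep›, FILE B
(CM transport) — FINDING #9 ∕ Q-D1 memo `F0/P3c/LH4/LH4-p02/g8/MEMO-QD1-second-test-function.v1.md` §(ii)(a); 2026-09-02.
-/
import Literature.NumberTheory.Rogawski1990.UnipotentOrbitalIntegralLevelPiecesCM      -- ★ RANK (F0P3a-p08 (g18)): the tame `m = 0` head and ALL its suppliers (FILE 0 ∕ 1 ∕ 2a, ★ p846366, ★ p846530, clopen balls)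
import Literature.NumberTheory.Automorphic.UnitaryThreeTransvectionShellParity        -- ★ p851786 (this seat) FILE A: parity at any depth, `sq_zero_unipotent_cases_level`, `cornerUnipotent_pow_mul_facts`
import HarnessLib

/-!
# ‹RANK-deep›: reference pieces at DEPTH `d` — `1_{K(d+2)}, 1_{K(d+1)∖K(d+2)}, 1_{K(d)∖K(d+1)}, 1_R` — whose unipotent orbital integrals form an invertible matrix, at an
# unramified non-split place of good reduction (any residue characteristic; the tame ★ `exists_levelPieces_det_classOrbitalIntegral_ne_zero` is `d = 0`)

Topic `NumberTheory/Rogawski1990`; namespace `Literature.NumberTheory.Rogawski1990`.  THEOREMS ONLY (no definition, no instance, no notation, no named fact, no `sorry`;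
axioms ⊆ {propext, Classical.choice, Quot.sound}).  Cell `pub/hodgecm-mathlib` (D-0151), crux H413 = `stmt-HodgeConjecture-24833`; half A line LH4, DYADIC pay-down leaf
`Cruxes/H413/Lines/F0_P3c_DyadicPaydown.lean`, organ (D-UNR) (PRINT by D74′).  LH4-plan (g6) FINDING #7∕#9 (Q-D1): at a dyadic hyperspecial place the tame reference pieces of
levels `≤ 2` cannot be transferred through the Möbius lift `K₂ → K₁`; the identity core's ‹RANK› input is therefore re-issued at an ARBITRARY depth `d`, where the
deep Möbius chart (★ p851712 (D4), `j ≥ e+1`) and the direct level-`d` counts («DEEP T3′») live.  THIS FILE is the CM TRANSPORT of ★ FILE A's field half, word for word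
the skeleton of ★ RANK (`UnipotentOrbitalIntegralLevelPiecesCM`, F0P3a-p08) with the levels `(2, 1, 0)` replaced by `(d+2, d+1, d)` and the level-`0` parity lemma replaced by
★ FILE A `forall_v_conj_cornerUnipotent_pow_succ_sub_one_apply_le`.  HONEST LABEL: HC_CM is proved only modulo the 7 printed citations (2 remaining named inputs: hLiu418 =
stmt-HodgeConjecture-24832, h413 = stmt-HodgeConjecture-24833) until rung 0 closes; BANKED base layer — consumers none live ((D-UNR) is PRINT; a «DEEP T3′» road is not open);
count-neutral, pays no organ, opens no road.

THE MATHEMATICS (through the frame `ψ = T·e(·)·T⁻¹ : G′_v ≅ U(σ_w, J₀)(L_w)` of ★ FILE 2a; `K(j) = {ψy ≡ 1 (𝔪_w^j)}`, `R = {y ∈ K : (ψy − 1)² ≢ 0 (𝔪_w)}`).  The unipotent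
classes are `1`, `[n(ϖ^{d+1} δ)]`, `[n(ϖ^d δ)]`, `reg` (★ FILE A `sq_zero_unipotent_cases_level`: the two singular classes read at depth `d`; which one is Rogawski's `[n(ϖδ)]`
is the parity of `d`).  With `P(1) = K(d+2)`, `P([n(ϖ^{d+1}δ)]) = K(d+1) ∖ K(d+2)`, `P([n(ϖ^d δ)]) = K(d) ∖ K(d+1)`, `P(reg) = R`, rank `0,1,2,3`, the table
`(Φ_{mU}(u, 1_{P u′}))` is lower-triangular with non-zero diagonal: `1` misses the two shells and `R`; the transvection classes miss `R`; **`[n(ϖ^{d+1} δ)]` misses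
`K(d) ∖ K(d+1)`** (★ FILE A: the content of a conjugate of `n(t)`, `|t| = exp(−(d+1))`, has the parity of `d + 1`); `n(ϖ^{d+1}δ) ∈ K(d+1) ∖ K(d+2)`, `n(ϖ^d δ) ∈ K(d) ∖ K(d+1)`,
`u(1,−t₀) ∈ R`.  The pieces are clopen, inside `K`, `Ad K`-stable and LEFT-`K(d+2)`-stable (the honest clause at depth `d`; the tame socket's «left-`K(2)`» is the case `d = 0`),
and ★ `det_classOrbitalIntegral_indicator_ne_zero` (p846366) gives `det ≠ 0`.

* §1 `forall_levelToken_iff (j)`, `mem_cmLocalIntegralLevel_of_levelToken (1 ≤ j)` — END's level token at ANY exponent `j` through `ψ` (★ FILE 2a :199∕:219 are `j = 2`).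
* §2 **`exists_deepLevelPieces_det_classOrbitalIntegral_ne_zero (d : ℕ)`** — ★ RANK's statement with the left-invariance clause at level `d + 2`; `d = 0` re-proves ★ RANK
  (cited, not restated: the tame statement keeps its own name and binder `_h2`).

## References
* [Rogawski1990] J. D. Rogawski, *Automorphic Representations of Unitary Groups in Three Variables*, Ann. of Math. Stud. 123 (1990), §8.1 pp. 112–114 (germs indexed by the
  unipotent classes; Prop. 8.1.2); §3.9 Prop. 3.9.1 p. 32; §4.9 p. 54 (congruence levels).
* [HarishChandra1999AdmissibleDistributions] Harish-Chandra, *Admissible Invariant Distributions on Reductive p-adic Groups*, AMS ULS 16 (1999), §3.1 p. 17.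
* [Serre1979] J.-P. Serre, *Local Fields*, GTM 67 (1979), Ch. V §2 Prop. 3 (`U_F = N U_E`, unramified).
-/

set_option autoImplicit false

noncomputable section

open scoped WithZero Matrix MatrixGroups ValuativeRel
open Topology Set NumberField IsDedekindDomain Matrix MeasureTheory

namespace Literature.NumberTheory.Rogawski1990

open Literature.NumberTheory.Automorphic Literature.NumberTheory.Automorphic.UnitaryGroup Literature.NumberTheory.GaloisRepresentations
open Literature.NumberTheory.Automorphic.UnitaryLatticeTree Literature.NumberTheory.Automorphic.HermitianLattice Literature.MeasureTheory.Group
open Literature.NumberTheory.LocalFields.UnramifiedQuadraticNorm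

/-! ## §1 END's level token at any exponent `j` through `ψ` -/

section Token

variable (L : Type) [Field L] [NumberField L] [IsCMField L] (H' : Matrix (Fin 3) (Fin 3) L) (v : HeightOneSpectrum (𝓞 ↥(maximalRealSubfield L)))
  (w : PlacesOver L v) (hw : IsCMField.complexConj L • w.1 = w.1)
  {T : GL (Fin 3) (w.1.adicCompletion L)}

/-- **The level-`j` token through `ψ`**: `∀ a b, |(ι_w(ϖ_v)^j)⁻¹·((e u)_{ab} − 1_{ab})|_w ≤ 1` says exactly that every entry of `ψ(u) − 1 = T(e u − 1)T⁻¹` has valuation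
`≤ exp(−j)` (`|ι_w(ϖ_v)| = exp(−1)` at an unramified place ★ `valued_toPlace_uniformizer`; `T ∈ GL₃(𝒪_w)` preserves levels ★ `forall_v_conj_sub_one_apply_le_iff`).  ★ FILE 2a
`forall_levelTwoToken_iff` is `j = 2`. [cite: Rogawski1990, §4.9 p. 54] -/
theorem forall_levelToken_iff (hv : Algebra.IsUnramifiedIn (𝓞 L) v.asIdeal) (hTint : T ∈ glInt 3 (w.1.adicCompletion L)) (j : ℕ) (u : (cmDatum L 3 H').Local v) :
    (∀ a b, Valued.v (((toPlace v w (HeckeCharacter.uniformizer ↥(maximalRealSubfield L) v : v.adicCompletion ↥(maximalRealSubfield L))) ^ j)⁻¹ *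
        ((((localNonsplitEquiv (IsCMField.complexConj L) H' (IsCMField.complexConj_ne_one L) w hw u :
            ↥(unitaryGroupOfForm (galAdicCompletionMap (L := L) (IsCMField.complexConj L) hw) (placeForm H' w.1))) : GL (Fin 3) (w.1.adicCompletion L)) :
              Matrix (Fin 3) (Fin 3) (w.1.adicCompletion L)) a b - (1 : Matrix (Fin 3) (Fin 3) (w.1.adicCompletion L)) a b)) ≤ 1) ↔
      ∀ a b, Valued.v ((((T * ((localNonsplitEquiv (IsCMField.complexConj L) H' (IsCMField.complexConj_ne_one L) w hw u :
        ↥(unitaryGroupOfForm (galAdicCompletionMap (L := L) (IsCMField.complexConj L) hw) (placeForm H' w.1))) : GL (Fin 3) (w.1.adicCompletion L)) * T⁻¹ :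
          GL (Fin 3) (w.1.adicCompletion L)) : Matrix (Fin 3) (Fin 3) (w.1.adicCompletion L)) - 1) a b) ≤ WithZero.exp (-(j : ℤ)) := by
  obtain ⟨hTi, hTii⟩ := isIntMatrix_frame L v w hTint
  have hϖ := valued_toPlace_uniformizer L v w hv
  have hϖj : ((toPlace v w (HeckeCharacter.uniformizer ↥(maximalRealSubfield L) v : v.adicCompletion ↥(maximalRealSubfield L))) ^ j) ≠ 0 :=
    pow_ne_zero _ (toPlace_uniformizer_ne_zero L v w hv)
  have hvj : Valued.v ((toPlace v w (HeckeCharacter.uniformizer ↥(maximalRealSubfield L) v : v.adicCompletion ↥(maximalRealSubfield L))) ^ j) =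
      WithZero.exp (-(j : ℤ)) := by
    rw [map_pow, hϖ, ← WithZero.exp_nsmul]
    congr 1
    simp
  rw [forall_v_conj_sub_one_apply_le_iff hTi hTii]
  refine forall_congr' fun a => forall_congr' fun b => ?_
  rw [v_inv_mul_le_one_iff hϖj, hvj, Matrix.sub_apply]

/-- An element satisfying the level-`j` token, `j ≥ 1`, lies in the hyperspecial `K_std` (★ FILE 2a `mem_cmLocalIntegralLevel_of_levelTwoToken` is `j = 2`).
[cite: Rogawski1990, §4.9 p. 54] -/
theorem mem_cmLocalIntegralLevel_of_levelToken
    (hT : placeForm H' w.1 = formCongr (galAdicCompletionMap (L := L) (IsCMField.complexConj L) hw) T ((StdForm.antidiagonal 3).over (w.1.adicCompletion L)))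
    (hv : Algebra.IsUnramifiedIn (𝓞 L) v.asIdeal) (hTint : T ∈ glInt 3 (w.1.adicCompletion L)) {j : ℕ} (hj : 1 ≤ j) {u : (cmDatum L 3 H').Local v}
    (hu : ∀ a b, Valued.v (((toPlace v w (HeckeCharacter.uniformizer ↥(maximalRealSubfield L) v : v.adicCompletion ↥(maximalRealSubfield L))) ^ j)⁻¹ *
        ((((localNonsplitEquiv (IsCMField.complexConj L) H' (IsCMField.complexConj_ne_one L) w hw u :
            ↥(unitaryGroupOfForm (galAdicCompletionMap (L := L) (IsCMField.complexConj L) hw) (placeForm H' w.1))) : GL (Fin 3) (w.1.adicCompletion L)) :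
              Matrix (Fin 3) (Fin 3) (w.1.adicCompletion L)) a b - (1 : Matrix (Fin 3) (Fin 3) (w.1.adicCompletion L)) a b)) ≤ 1) :
    u ∈ cmLocalIntegralLevel L 3 H' v := by
  rw [mem_cmLocalIntegralLevel_iff_isIntMatrix_conj L H' v w hw hT hTint]
  have h := (forall_levelToken_iff L H' v w hw hv hTint j u).1 hu
  have hle : WithZero.exp (-(j : ℤ)) ≤ (1 : ℤᵐ⁰) := by rw [← WithZero.exp_zero, WithZero.exp_le_exp]; omega
  have h1 : IsIntMatrix (((T * ((localNonsplitEquiv (IsCMField.complexConj L) H' (IsCMField.complexConj_ne_one L) w hw u :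
        ↥(unitaryGroupOfForm (galAdicCompletionMap (L := L) (IsCMField.complexConj L) hw) (placeForm H' w.1))) : GL (Fin 3) (w.1.adicCompletion L)) * T⁻¹ :
          GL (Fin 3) (w.1.adicCompletion L)) : Matrix (Fin 3) (Fin 3) (w.1.adicCompletion L)) - 1) := fun a b => (h a b).trans hle
  have := isIntMatrix_add h1 isIntMatrix_one
  rwa [sub_add_cancel] at this

end Token

/-! ## §2 The deep RANK head -/

set_option maxHeartbeats 1600000 in
open scoped Classical in
/-- **‹RANK-deep› AT DEPTH `d`, CM INSTANTIATION**: at a non-split place `v` unramified in `L` with `H′_w ∈ GL₃(𝒪_w)` (ANY residue characteristic), for every finite set `S` of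
UNIPOTENT classes of `U(H′)(L⁺_v)` and every orbital-measure family `mU` admissible on `S` with the Rao clause, there are reference pieces `g_u ∈ C_c^∞` (`u ∈ S`) supported
in the hyperspecial `K`, `Ad K`-invariant, left-invariant under the level-`(d+2)` congruence set, with `det (Φ_{mU}(u, g_{u′}))_{u,u′ ∈ S} ≠ 0` — the pieces
`1_{K(d+2)}, 1_{K(d+1)∖K(d+2)}, 1_{K(d)∖K(d+1)}, 1_R` by the class's type, lower-triangular in the rank order (★ p846366).  `d = 0` is ★
`exists_levelPieces_det_classOrbitalIntegral_ne_zero`. [cite: Rogawski1990, §8.1 Prop. 8.1.2 p. 114; §3.9 Prop. 3.9.1 p. 32; §4.9 p. 54]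
[cite: HarishChandra1999AdmissibleDistributions, §3.1 p. 17] [cite: Serre1979, Ch. V §2 Prop. 3] -/
theorem exists_deepLevelPieces_det_classOrbitalIntegral_ne_zero
    (L : Type) [Field L] [NumberField L] [IsCMField L] (H' : Matrix (Fin 3) (Fin 3) L)
    {v : HeightOneSpectrum (𝓞 ↥(maximalRealSubfield L))}
    (hH' : (H'.map (cmConjRingHom L)).transpose = H') (w : PlacesOver L v)
    (hw : IsCMField.complexConj L • w.1 = w.1) (hv : Algebra.IsUnramifiedIn (𝓞 L) v.asIdeal)
    (hH'w : IsUnit (placeForm H' w.1)) (hH'i : hH'w.unit ∈ glInt 3 (w.1.adicCompletion L)) (d : ℕ)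
    [MeasurableSpace ((cmDatum L 3 H').Local v)] [BorelSpace ((cmDatum L 3 H').Local v)]
    [∀ γ : ((cmDatum L 3 H').Local v), MeasurableSpace (((cmDatum L 3 H').Local v) ⧸ Subgroup.centralizer ({γ} : Set ((cmDatum L 3 H').Local v)))]
    [∀ γ : ((cmDatum L 3 H').Local v), BorelSpace (((cmDatum L 3 H').Local v) ⧸ Subgroup.centralizer ({γ} : Set ((cmDatum L 3 H').Local v)))]
    -- the unipotent datum: conjuncts (i)–(iii) of ★ `ShalikaGermExpansionNonsplit` VERBATIM
    (S : Finset (ConjClasses ((cmDatum L 3 H').Local v)))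
    (hS : ∀ u ∈ S, (((Quotient.out u : (cmDatum L 3 H').Local v).val : GL (Fin 3) (UnitaryGroup.LocalRing L v)).val - 1) ^ 3 = 0)
    (mU : OrbitalMeasureFamily ((cmDatum L 3 H').Local v)) (hmU : mU.IsAdmissibleOn (fun γ => (ConjClasses.mk γ) ∈ S))
    (hRao : ∀ u ∈ S, ∀ f : (cmDatum L 3 H').Local v → ℂ, IsLocSmooth f →
      Integrable (descConj (Quotient.out u : (cmDatum L 3 H').Local v)
        (Subgroup.centralizer ({(Quotient.out u : (cmDatum L 3 H').Local v)} : Set ((cmDatum L 3 H').Local v)))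
        (fun _ hg => Subgroup.mem_centralizer_singleton_iff.1 hg) f) (mU u)) :
    ∃ gref : ↥S → ((cmDatum L 3 H').Local v) → ℂ,
      (∀ i, IsLocSmooth (gref i)) ∧
      (∀ i, tsupport (gref i) ⊆ (cmLocalIntegralLevel L 3 H' v : Set ((cmDatum L 3 H').Local v))) ∧
      (∀ i, ∀ u ∈ cmLocalIntegralLevel L 3 H' v, ∀ x, gref i (u * x * u⁻¹) = gref i x) ∧
      (∀ i, ∀ u : (cmDatum L 3 H').Local v,
        (∀ a b, Valued.v (((toPlace v w (HeckeCharacter.uniformizer ↥(maximalRealSubfield L) v : v.adicCompletion ↥(maximalRealSubfield L))) ^ (d + 2))⁻¹ *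
          ((((localNonsplitEquiv (IsCMField.complexConj L) H' (IsCMField.complexConj_ne_one L) w hw u :
              ↥(unitaryGroupOfForm (galAdicCompletionMap (L := L) (IsCMField.complexConj L) hw) (placeForm H' w.1))) : GL (Fin 3) (w.1.adicCompletion L)) :
                Matrix (Fin 3) (Fin 3) (w.1.adicCompletion L)) a b - (1 : Matrix (Fin 3) (Fin 3) (w.1.adicCompletion L)) a b)) ≤ 1) →
        ∀ x, gref i (u * x) = gref i x) ∧
      (Matrix.of fun u u' : ↥S => classOrbitalIntegral mU (gref u') u).det ≠ 0 := by
  classical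
  -- ## 0. The frame `ψ = T·e(·)·T⁻¹ : G′_v → U(σ_w, J₀)(L_w)` (★ FILE 2a) and the unramified datum at `w`
  obtain ⟨T, hTint, hT⟩ := exists_glInt_placeForm_eq_formCongr_antidiagonal_of_isUnramifiedIn (↥(maximalRealSubfield L)) L (IsCMField.complexConj L)
    (IsCMField.complexConj_ne_one L) 3 H' hH' v w hw hv hH'w hH'i
  obtain ⟨ψ, hψ⟩ : ∃ ψ : (cmDatum L 3 H').Local v → GL (Fin 3) (w.1.adicCompletion L), ∀ y, ψ y =
      T * ((localNonsplitEquiv (IsCMField.complexConj L) H' (IsCMField.complexConj_ne_one L) w hw y :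
        ↥(unitaryGroupOfForm (galAdicCompletionMap (L := L) (IsCMField.complexConj L) hw) (placeForm H' w.1))) : GL (Fin 3) (w.1.adicCompletion L)) * T⁻¹ :=
    ⟨_, fun _ => rfl⟩
  -- the `ψ`-dictionary (★ FILE 2a, rewritten through `hψ`)
  have hψU : ∀ y, ψ y ∈ unitaryGroupOfForm (galAdicCompletionMap (L := L) (IsCMField.complexConj L) hw) ((StdForm.antidiagonal 3).over (w.1.adicCompletion L)) :=
    fun y => by rw [hψ]; exact conj_localNonsplitEquiv_mem L H' v w hw hT y
  have hψmul : ∀ y y', ψ (y * y') = ψ y * ψ y' := fun y y' => by simp only [hψ]; exact conj_localNonsplitEquiv_mul L H' v w hw y y'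
  have hψinv : ∀ y, ψ y⁻¹ = (ψ y)⁻¹ := fun y => by simp only [hψ]; exact conj_localNonsplitEquiv_inv L H' v w hw y
  have hψsurj : ∀ g ∈ unitaryGroupOfForm (galAdicCompletionMap (L := L) (IsCMField.complexConj L) hw) ((StdForm.antidiagonal 3).over (w.1.adicCompletion L)),
      ∃ y, ψ y = g := fun g hg => by simp only [hψ]; exact exists_conj_localNonsplitEquiv_eq L H' v w hw hT hg
  have hψK : ∀ y, y ∈ cmLocalIntegralLevel L 3 H' v ↔ IsIntMatrix ((ψ y : GL (Fin 3) (w.1.adicCompletion L)) : Matrix (Fin 3) (Fin 3) (w.1.adicCompletion L)) :=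
    fun y => by rw [hψ]; exact mem_cmLocalIntegralLevel_iff_isIntMatrix_conj L H' v w hw hT hTint y
  have hψconj : ∀ y y', ConjClasses.mk y = ConjClasses.mk y' ↔
      ∃ k : GL (Fin 3) (w.1.adicCompletion L), k ∈ unitaryGroupOfForm (galAdicCompletionMap (L := L) (IsCMField.complexConj L) hw)
        ((StdForm.antidiagonal 3).over (w.1.adicCompletion L)) ∧ k * ψ y * k⁻¹ = ψ y' :=
    fun y y' => by simp only [hψ]; exact conjClasses_mk_eq_iff_exists_conj L H' v w hw hT y y'
  have hψcont : ∀ a b, Continuous fun y => ((ψ y : GL (Fin 3) (w.1.adicCompletion L)) : Matrix (Fin 3) (Fin 3) (w.1.adicCompletion L)) a b := fun a b => by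
    simp only [hψ]; exact continuous_conj_localNonsplitEquiv_apply L H' v w hw a b
  have hψnil : ∀ u ∈ S, (((ψ (Quotient.out u) : GL (Fin 3) (w.1.adicCompletion L)) : Matrix (Fin 3) (Fin 3) (w.1.adicCompletion L)) - 1) ^ 3 = 0 :=
    fun u hu => by rw [hψ]; exact conj_localNonsplitEquiv_sub_one_pow_eq_zero L H' v w hw (hS u hu)
  have hout : ∀ c : ConjClasses ((cmDatum L 3 H').Local v), ConjClasses.mk (Quotient.out c) = c := fun c => by
    rw [← ConjClasses.quotient_mk_eq_mk, Quotient.out_eq]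
  -- the unramified datum at `w`: `σ_w` an involution preserving `|·|_w`, a `σ_w`-fixed uniformiser, (trace); units of `L⁺_v` are norms; a `σ_w`-skew unit `δ`
  obtain ⟨ϖ, hd⟩ := unramifiedLocalConjDatum_adicCompletion (IsCMField.complexConj L) (IsCMField.complexConj_ne_one L) v w hw hv
  have hcc : IsCMField.complexConj L * IsCMField.complexConj L = 1 := AlgEquiv.ext fun y => IsCMField.complexConj_apply_apply L y
  have hnormU : ∀ x : w.1.adicCompletion L, galAdicCompletionMap (L := L) (IsCMField.complexConj L) hw x = x → Valued.v x = 1 →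
      ∃ z : w.1.adicCompletion L, z * galAdicCompletionMap (L := L) (IsCMField.complexConj L) hw z = x := fun x hσx hvx =>
    exists_mul_galAdicCompletionMap_eq_of_valued_eq_one (IsCMField.complexConj L) v (IsCMField.complexConj_ne_one L) hcc hv w hw hσx hvx
  obtain ⟨δ, hσδ, hvδ⟩ := exists_galAdicCompletionMap_eq_neg_valued_eq_one (IsCMField.complexConj L) v (IsCMField.complexConj_ne_one L) hcc hv w hw
  obtain ⟨t₀, ht₀, htr⟩ := hd.trace
  haveI : CharZero (w.1.adicCompletion L) := charZero_of_injective_algebraMap (algebraMap L _).injective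
  have h2K : (2 : w.1.adicCompletion L) ≠ 0 := two_ne_zero
  -- the representatives `n₀ = n(ϖ^d δ)` (shell `d`), `n₁ = n(ϖ^{d+1} δ)` (shell `d + 1`), `u_reg = u(1, −t₀)` in `U(σ_w, J₀)(L_w)`
  obtain ⟨n₀, hn₀⟩ := exists_units_coe_eq_cornerUnipotent' (ϖ ^ d * δ)
  obtain ⟨n₁, hn₁⟩ := exists_units_coe_eq_cornerUnipotent' (ϖ ^ (d + 1) * δ)
  obtain ⟨ur, hur, -⟩ := exists_units_coe_eq_upperTriangularUnipotent (1 : w.1.adicCompletion L) (-t₀) (-1)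
  obtain ⟨IsCj, hIsCj⟩ : ∃ IsCj : GL (Fin 3) (w.1.adicCompletion L) → GL (Fin 3) (w.1.adicCompletion L) → Prop, ∀ g n, IsCj g n ↔
      ∃ k : GL (Fin 3) (w.1.adicCompletion L), k ∈ unitaryGroupOfForm (galAdicCompletionMap (L := L) (IsCMField.complexConj L) hw) ((StdForm.antidiagonal 3).over (w.1.adicCompletion L)) ∧ k * g * k⁻¹ = n := ⟨_, fun _ _ => Iff.rfl⟩
  -- the two shells' representatives: membership, integrality, square-zero, level EXACTLY `d` ∕ `d + 1` (★ FILE A `cornerUnipotent_pow_mul_facts`)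
  obtain ⟨hn₀U, hn₀int, -, -, hn₀le, hn₀not⟩ := cornerUnipotent_pow_mul_facts (galAdicCompletionMap (L := L) (IsCMField.complexConj L) hw) hd hσδ hvδ d hn₀
  obtain ⟨hn₁U, hn₁int, -, -, hn₁le, hn₁not⟩ := cornerUnipotent_pow_mul_facts (galAdicCompletionMap (L := L) (IsCMField.complexConj L) hw) hd hσδ hvδ (d + 1) hn₁
  have hcast1 : (((d + 1 : ℕ) : ℤ)) = (d : ℤ) + 1 := by push_cast; ring
  rw [hcast1] at hn₁le hn₁not
  have hcast2 : (d : ℤ) + 1 + 1 = (d : ℤ) + 2 := by ring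
  rw [hcast2] at hn₁not
  obtain ⟨hurU, hurint, -, hurreg, hurnil⟩ := upperUnipotentOne_facts (galAdicCompletionMap (L := L) (IsCMField.complexConj L) hw) hd.σσ ht₀ htr hur
  have hexp21 : WithZero.exp (-((d : ℤ) + 2)) ≤ WithZero.exp (-1 : ℤ) := WithZero.exp_le_exp.2 (by omega)
  have hexp20 : WithZero.exp (-((d : ℤ) + 2)) ≤ (1 : ℤᵐ⁰) := by rw [← WithZero.exp_zero]; exact WithZero.exp_le_exp.2 (by omega)
  have hexp2d1 : WithZero.exp (-((d : ℤ) + 2)) ≤ WithZero.exp (-((d : ℤ) + 1)) := WithZero.exp_le_exp.2 (by omega)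
  have hexp2d0 : WithZero.exp (-((d : ℤ) + 2)) ≤ WithZero.exp (-(d : ℤ)) := WithZero.exp_le_exp.2 (by omega)
  have hexp1lt : WithZero.exp (-1 : ℤ) < (1 : ℤᵐ⁰) := by rw [← WithZero.exp_zero]; exact WithZero.exp_lt_exp.2 (by norm_num)
  -- ## 1. The level predicates through `ψ` and the rank of a class
  obtain ⟨lev, hlev⟩ : ∃ lev : ℤ → (cmDatum L 3 H').Local v → Prop, ∀ m y, lev m y ↔
      ∀ a b, Valued.v ((((ψ y : GL (Fin 3) (w.1.adicCompletion L)) : Matrix (Fin 3) (Fin 3) (w.1.adicCompletion L)) - 1) a b) ≤ WithZero.exp m := ⟨_, fun _ _ => Iff.rfl⟩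
  obtain ⟨sq1, hsq1⟩ : ∃ sq1 : (cmDatum L 3 H').Local v → Prop, ∀ y, sq1 y ↔
      ∀ a b, Valued.v (((((ψ y : GL (Fin 3) (w.1.adicCompletion L)) : Matrix (Fin 3) (Fin 3) (w.1.adicCompletion L)) - 1) *
        (((ψ y : GL (Fin 3) (w.1.adicCompletion L)) : Matrix (Fin 3) (Fin 3) (w.1.adicCompletion L)) - 1)) a b) ≤ WithZero.exp (-1 : ℤ) := ⟨_, fun _ => Iff.rfl⟩
  obtain ⟨b, hb⟩ : ∃ b : ConjClasses ((cmDatum L 3 H').Local v) → ℕ, ∀ c, b c =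
      if ψ (Quotient.out c) = 1 then 0 else if IsCj (ψ (Quotient.out c)) n₁ then 1 else if IsCj (ψ (Quotient.out c)) n₀ then 2 else 3 := ⟨_, fun _ => rfl⟩
  obtain ⟨P, hP⟩ : ∃ P : ConjClasses ((cmDatum L 3 H').Local v) → Set ((cmDatum L 3 H').Local v), ∀ c, P c =
      if b c = 0 then {y | y ∈ cmLocalIntegralLevel L 3 H' v ∧ lev (-((d : ℤ) + 2)) y}
      else if b c = 1 then {y | y ∈ cmLocalIntegralLevel L 3 H' v ∧ lev (-((d : ℤ) + 1)) y ∧ ¬ lev (-((d : ℤ) + 2)) y}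
      else if b c = 2 then {y | y ∈ cmLocalIntegralLevel L 3 H' v ∧ lev (-(d : ℤ)) y ∧ ¬ lev (-((d : ℤ) + 1)) y}
      else {y | y ∈ cmLocalIntegralLevel L 3 H' v ∧ ¬ sq1 y} := ⟨_, fun _ => rfl⟩
  -- ## 2. Topology and invariance of the level sets
  obtain ⟨hKc, hKo⟩ := isCompact_isOpen_cmLocalIntegralLevel L 3 H' v
  have hKcl : IsClosed (cmLocalIntegralLevel L 3 H' v : Set ((cmDatum L 3 H').Local v)) := (cmLocalIntegralLevel L 3 H' v).isClosed_of_isOpen hKo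
  have hball : ∀ m : ℤ, IsClopen {x : w.1.adicCompletion L | Valued.v x ≤ WithZero.exp m} := fun m =>
    isClopen_setOf_valued_le L w.1 WithZero.exp_ne_zero
  have hψcontM : Continuous fun y => ((ψ y : GL (Fin 3) (w.1.adicCompletion L)) : Matrix (Fin 3) (Fin 3) (w.1.adicCompletion L)) :=
    continuous_pi fun a => continuous_pi fun c => hψcont a c
  have hlev_clopen : ∀ m, IsClopen {y | lev m y} := by
    intro m
    have hset : {y | lev m y} = ⋂ a : Fin 3, ⋂ c : Fin 3,
        (fun y => ((((ψ y : GL (Fin 3) (w.1.adicCompletion L)) : Matrix (Fin 3) (Fin 3) (w.1.adicCompletion L)) - 1) a c)) ⁻¹'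
          {x : w.1.adicCompletion L | Valued.v x ≤ WithZero.exp m} := by
      ext y; simp only [Set.mem_setOf_eq, hlev, Set.mem_iInter, Set.mem_preimage]
    rw [hset]
    exact isClopen_iInter_of_finite fun a => isClopen_iInter_of_finite fun c => (hball m).preimage ((hψcontM.sub continuous_const).matrix_elem a c)
  have hsq1_clopen : IsClopen {y | sq1 y} := by
    have hset : {y | sq1 y} = ⋂ a : Fin 3, ⋂ c : Fin 3,
        (fun y => (((((ψ y : GL (Fin 3) (w.1.adicCompletion L)) : Matrix (Fin 3) (Fin 3) (w.1.adicCompletion L)) - 1) *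
          (((ψ y : GL (Fin 3) (w.1.adicCompletion L)) : Matrix (Fin 3) (Fin 3) (w.1.adicCompletion L)) - 1)) a c)) ⁻¹'
          {x : w.1.adicCompletion L | Valued.v x ≤ WithZero.exp (-1 : ℤ)} := by
      ext y; simp only [Set.mem_setOf_eq, hsq1, Set.mem_iInter, Set.mem_preimage]
    rw [hset]
    exact isClopen_iInter_of_finite fun a => isClopen_iInter_of_finite fun c =>
      (hball (-1)).preimage (((hψcontM.sub continuous_const).mul (hψcontM.sub continuous_const)).matrix_elem a c)
  -- `Ad K`-invariance and left-`K(2)`-invariance of the basic predicates (★ FILE 0)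
  have hconjK : ∀ k ∈ cmLocalIntegralLevel L 3 H' v, ∀ y, k * y * k⁻¹ ∈ cmLocalIntegralLevel L 3 H' v ↔ y ∈ cmLocalIntegralLevel L 3 H' v := by
    intro k hk y
    refine ⟨fun h => ?_, fun h => mul_mem (mul_mem hk h) (inv_mem hk)⟩
    have h' := mul_mem (mul_mem (inv_mem hk) h) hk
    rwa [show k⁻¹ * (k * y * k⁻¹) * k = y by group] at h'
  have hψKinv : ∀ k ∈ cmLocalIntegralLevel L 3 H' v,
      IsIntMatrix (((ψ k)⁻¹ : GL (Fin 3) (w.1.adicCompletion L)) : Matrix (Fin 3) (Fin 3) (w.1.adicCompletion L)) := fun k hk => by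
    rw [← hψinv]; exact (hψK k⁻¹).1 (inv_mem hk)
  have hconj_lev : ∀ k ∈ cmLocalIntegralLevel L 3 H' v, ∀ m y, lev m (k * y * k⁻¹) ↔ lev m y := by
    intro k hk m y
    rw [hlev, hlev, hψmul, hψmul, hψinv]
    exact forall_v_conj_sub_one_apply_le_iff ((hψK k).1 hk) (hψKinv k hk) (ψ y) _
  have hconj_sq1 : ∀ k ∈ cmLocalIntegralLevel L 3 H' v, ∀ y, sq1 (k * y * k⁻¹) ↔ sq1 y := by
    intro k hk y
    rw [hsq1, hsq1, hψmul, hψmul, hψinv]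
    exact forall_v_conj_sub_one_sq_apply_le_iff ((hψK k).1 hk) (hψKinv k hk) (ψ y) _
  have hmulK : ∀ u ∈ cmLocalIntegralLevel L 3 H' v, ∀ y, u * y ∈ cmLocalIntegralLevel L 3 H' v ↔ y ∈ cmLocalIntegralLevel L 3 H' v :=
    fun u hu y => Subgroup.mul_mem_cancel_left _ hu
  have hmul_lev : ∀ u, lev (-((d : ℤ) + 2)) u → ∀ y ∈ cmLocalIntegralLevel L 3 H' v, ∀ m, m = -(d : ℤ) ∨ m = -((d : ℤ) + 1) ∨ m = -((d : ℤ) + 2) →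
      (lev m (u * y) ↔ lev m y) := by
    intro u hu2 y hy m hm
    rw [hlev, hlev, hψmul]
    refine forall_v_mul_sub_one_apply_le_iff ((hlev (-((d : ℤ) + 2)) u).1 hu2) ((hψK y).1 hy) ?_
    rcases hm with rfl | rfl | rfl <;> [exact hexp2d0; exact hexp2d1; exact le_rfl]
  have hmul_sq1 : ∀ u, lev (-((d : ℤ) + 2)) u → ∀ y ∈ cmLocalIntegralLevel L 3 H' v, (sq1 (u * y) ↔ sq1 y) := by
    intro u hu2 y hy
    rw [hsq1, hsq1, hψmul]
    exact forall_v_mul_sub_one_sq_apply_le_iff ((hlev (-((d : ℤ) + 2)) u).1 hu2) ((hψK y).1 hy) hexp21 hexp20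
  -- the pieces: clopen, inside `K`, `Ad K`-stable, left-`K(2)`-stable
  have hPK : ∀ c, P c ⊆ (cmLocalIntegralLevel L 3 H' v : Set ((cmDatum L 3 H').Local v)) := fun c y hy => by
    rw [hP c] at hy; split_ifs at hy <;> exact hy.1
  have hKclopen : IsClopen (cmLocalIntegralLevel L 3 H' v : Set ((cmDatum L 3 H').Local v)) := ⟨hKcl, hKo⟩
  have hPclopen : ∀ c, IsClopen (P c) := fun c => by
    rw [hP c]; split_ifs
    · exact hKclopen.inter (hlev_clopen _)
    · exact hKclopen.inter ((hlev_clopen _).inter (hlev_clopen _).compl)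
    · exact hKclopen.inter ((hlev_clopen _).inter (hlev_clopen _).compl)
    · exact hKclopen.inter hsq1_clopen.compl
  have hPo : ∀ c ∈ S, IsOpen (P c) := fun c _ => (hPclopen c).isOpen
  have hPcl : ∀ c ∈ S, IsClosed (P c) := fun c _ => (hPclopen c).isClosed
  have hPc : ∀ c ∈ S, IsCompact (P c) := fun c _ => hKc.of_isClosed_subset (hPclopen c).isClosed (hPK c)
  have hPconj : ∀ c, ∀ k ∈ cmLocalIntegralLevel L 3 H' v, ∀ y, k * y * k⁻¹ ∈ P c ↔ y ∈ P c := fun c k hk y => by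
    rw [hP c]; split_ifs <;> simp only [Set.mem_setOf_eq, hconjK k hk, hconj_lev k hk, hconj_sq1 k hk]
  -- left translation: the level conjuncts are read only inside `K`
  have hand : ∀ (p : (cmDatum L 3 H').Local v → Prop) (u : (cmDatum L 3 H').Local v), u ∈ cmLocalIntegralLevel L 3 H' v →
      (∀ y ∈ cmLocalIntegralLevel L 3 H' v, (p (u * y) ↔ p y)) →
      ∀ y, (u * y ∈ cmLocalIntegralLevel L 3 H' v ∧ p (u * y) ↔ y ∈ cmLocalIntegralLevel L 3 H' v ∧ p y) := fun p u huK hp y =>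
    ⟨fun h => ⟨(hmulK u huK y).1 h.1, (hp y ((hmulK u huK y).1 h.1)).1 h.2⟩, fun h => ⟨(hmulK u huK y).2 h.1, (hp y h.1).2 h.2⟩⟩
  have hPmul : ∀ c, ∀ u, u ∈ cmLocalIntegralLevel L 3 H' v → lev (-((d : ℤ) + 2)) u → ∀ y, u * y ∈ P c ↔ y ∈ P c := fun c u huK hu2 y => by
    rw [hP c]; split_ifs
    · exact hand _ u huK (fun y hy => hmul_lev u hu2 y hy _ (Or.inr (Or.inr rfl))) y
    · exact hand (fun y => lev (-((d : ℤ) + 1)) y ∧ ¬ lev (-((d : ℤ) + 2)) y) u huK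
        (fun y hy => and_congr (hmul_lev u hu2 y hy _ (Or.inr (Or.inl rfl))) (not_congr (hmul_lev u hu2 y hy _ (Or.inr (Or.inr rfl))))) y
    · exact hand (fun y => lev (-(d : ℤ)) y ∧ ¬ lev (-((d : ℤ) + 1)) y) u huK
        (fun y hy => and_congr (hmul_lev u hu2 y hy _ (Or.inl rfl)) (not_congr (hmul_lev u hu2 y hy _ (Or.inr (Or.inl rfl))))) y
    · exact hand (fun y => ¬ sq1 y) u huK (fun y hy => not_congr (hmul_sq1 u hu2 y hy)) y
  -- ## 3. The rank: the four values and the classification (★ FILE 1)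
  have hb_le : ∀ c, b c ≤ 3 := fun c => by rw [hb c]; split_ifs <;> omega
  have hb0 : ∀ c, b c = 0 ↔ ψ (Quotient.out c) = 1 := fun c => by
    rw [hb c]
    split_ifs with h0 <;> first | exact iff_of_true rfl h0 | exact iff_of_false (by decide) h0
  have hb1 : ∀ c, b c = 1 ↔ ¬ ψ (Quotient.out c) = 1 ∧ IsCj (ψ (Quotient.out c)) n₁ := fun c => by
    rw [hb c]
    split_ifs with h0 h1 h2
    · exact iff_of_false (by decide) fun h => h.1 h0
    · exact iff_of_true rfl ⟨h0, h1⟩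
    · exact iff_of_false (by decide) fun h => h1 h.2
    · exact iff_of_false (by decide) fun h => h1 h.2
  have hb2 : ∀ c, b c = 2 ↔ ¬ ψ (Quotient.out c) = 1 ∧ ¬ IsCj (ψ (Quotient.out c)) n₁ ∧ IsCj (ψ (Quotient.out c)) n₀ := fun c => by
    rw [hb c]
    split_ifs with h0 h1 h2
    · exact iff_of_false (by decide) fun h => h.1 h0
    · exact iff_of_false (by decide) fun h => h.2.1 h1
    · exact iff_of_true rfl ⟨h0, h1, h2⟩
    · exact iff_of_false (by decide) fun h => h2 h.2.2
  -- the unipotent `ψ(out u)`, `u ∈ S`, is REGULAR when its rank is `3` (★ FILE 1 `sq_zero_unipotent_cases`)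
  have hreg3 : ∀ u ∈ S, b u = 3 →
      (((ψ (Quotient.out u) : GL (Fin 3) (w.1.adicCompletion L)) : Matrix (Fin 3) (Fin 3) (w.1.adicCompletion L)) - 1) *
        (((ψ (Quotient.out u) : GL (Fin 3) (w.1.adicCompletion L)) : Matrix (Fin 3) (Fin 3) (w.1.adicCompletion L)) - 1) ≠ 0 := by
    intro u _ h3 hsq
    have hbu := hb u
    split_ifs at hbu with h0 h1 h2 <;> try omega
    rcases sq_zero_unipotent_cases_level (galAdicCompletionMap (L := L) (IsCMField.complexConj L) hw) hd hnormU hσδ hvδ d hn₀ hn₁ (hψU _) hsq with h | h | h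
    · exact h0 h
    · exact h2 ((hIsCj _ _).2 h)
    · exact h1 ((hIsCj _ _).2 h)
  -- ## 4. The table: diagonal representatives and above-diagonal zeros
  have hlev_one : ∀ y m, ψ y = 1 → lev m y := fun y m hy => by
    rw [hlev]; intro a c
    rw [hy, Units.val_one, sub_self, Matrix.zero_apply, map_zero]; exact zero_le
  have hPx : ∀ u ∈ S, ∃ x ∈ P u, ConjClasses.mk x = u := by
    intro u hu
    have hcases : b u = 0 ∨ b u = 1 ∨ b u = 2 ∨ b u = 3 := by have := hb_le u; omega
    rcases hcases with h0 | h1 | h2 | h3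
    · -- the class of `1`: `x = out u` itself lies in `K(2)`
      have hψ1 := (hb0 u).1 h0
      refine ⟨Quotient.out u, ?_, hout u⟩
      rw [hP u, if_pos h0]
      exact ⟨(hψK _).2 (by rw [hψ1, Units.val_one]; exact isIntMatrix_one), hlev_one _ _ hψ1⟩
    · -- the class of `n(ϖ^{d+1} δ)`: `x = ψ⁻¹ n(ϖ^{d+1} δ) ∈ K(d+1) ∖ K(d+2)`
      obtain ⟨k, hk, hkn⟩ := (hIsCj _ _).1 ((hb1 u).1 h1).2
      obtain ⟨x, hx⟩ := hψsurj n₁ hn₁U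
      refine ⟨x, ?_, ?_⟩
      · rw [hP u, if_neg (by omega), if_pos h1]
        refine ⟨(hψK x).2 (by rw [hx]; exact hn₁int), (hlev _ _).2 (by rw [hx]; exact hn₁le), fun h => hn₁not ?_⟩
        rw [← hx]; exact (hlev _ _).1 h
      · rw [← hout u, hψconj]
        exact ⟨k⁻¹, inv_mem hk, by rw [hx, ← hkn]; group⟩
    · -- the class of `n(ϖ^d δ)`: `x = ψ⁻¹ n(ϖ^d δ) ∈ K(d) ∖ K(d+1)`
      obtain ⟨k, hk, hkn⟩ := (hIsCj _ _).1 ((hb2 u).1 h2).2.2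
      obtain ⟨x, hx⟩ := hψsurj n₀ hn₀U
      refine ⟨x, ?_, ?_⟩
      · rw [hP u, if_neg (by omega), if_neg (by omega), if_pos h2]
        refine ⟨(hψK x).2 (by rw [hx]; exact hn₀int), (hlev _ _).2 (by rw [hx]; exact hn₀le), fun h => hn₀not ?_⟩
        rw [← hx]; exact (hlev _ _).1 h
      · rw [← hout u, hψconj]
        exact ⟨k⁻¹, inv_mem hk, by rw [hx, ← hkn]; group⟩
    · -- `reg`: `x = ψ⁻¹ u(1, −t₀) ∈ R` (ONE regular class, ★ `exists_conj_eq_of_regular_unipotent`)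
      have hreg := hreg3 u hu h3
      obtain ⟨k, hk, hkr⟩ := exists_conj_eq_of_regular_unipotent (galAdicCompletionMap (L := L) (IsCMField.complexConj L) hw) hd.σσ h2K (hψU _) hurU
        ⟨3, hψnil u hu⟩ hurnil hreg hurreg
      obtain ⟨x, hx⟩ := hψsurj ur hurU
      refine ⟨x, ?_, ?_⟩
      · rw [hP u, if_neg (by omega), if_neg (by omega), if_neg (by omega)]
        exact ⟨(hψK x).2 (by rw [hx]; exact hurint), fun h => not_forall_v_upperUnipotentOne_sub_one_sq_apply_le hur hexp1lt (by rw [← hx]; exact (hsq1 x).1 h)⟩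
      · rw [← hout u, hψconj]
        exact ⟨k⁻¹, inv_mem hk, by rw [hx, ← hkr]; group⟩
  have hbinj : Set.InjOn b ↑S := by
    intro c hc c' hc' hcc'
    rw [Finset.mem_coe] at hc hc'
    suffices hk : IsCj (ψ (Quotient.out c)) (ψ (Quotient.out c')) by
      rw [← hout c, ← hout c']
      exact (hψconj _ _).2 ((hIsCj _ _).1 hk)
    rw [hIsCj]
    have hcases : b c = 0 ∨ b c = 1 ∨ b c = 2 ∨ b c = 3 := by have := hb_le c; omega
    rcases hcases with h0 | h1 | h2 | h3
    · refine ⟨1, one_mem _, ?_⟩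
      rw [(hb0 c).1 h0, (hb0 c').1 (by omega), mul_one, one_mul, inv_one]
    · obtain ⟨k, hk, hkn⟩ := (hIsCj _ _).1 ((hb1 c).1 h1).2
      obtain ⟨k', hk', hkn'⟩ := (hIsCj _ _).1 ((hb1 c').1 (by omega)).2
      refine ⟨k'⁻¹ * k, mul_mem (inv_mem hk') hk, ?_⟩
      rw [show k'⁻¹ * k * ψ (Quotient.out c) * (k'⁻¹ * k)⁻¹ = k'⁻¹ * (k * ψ (Quotient.out c) * k⁻¹) * k' by group, hkn, ← hkn']
      group
    · obtain ⟨k, hk, hkn⟩ := (hIsCj _ _).1 ((hb2 c).1 h2).2.2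
      obtain ⟨k', hk', hkn'⟩ := (hIsCj _ _).1 ((hb2 c').1 (by omega)).2.2
      refine ⟨k'⁻¹ * k, mul_mem (inv_mem hk') hk, ?_⟩
      rw [show k'⁻¹ * k * ψ (Quotient.out c) * (k'⁻¹ * k)⁻¹ = k'⁻¹ * (k * ψ (Quotient.out c) * k⁻¹) * k' by group, hkn, ← hkn']
      group
    · exact exists_conj_eq_of_regular_unipotent (galAdicCompletionMap (L := L) (IsCMField.complexConj L) hw) hd.σσ h2K (hψU _) (hψU _)
        ⟨3, hψnil c hc⟩ ⟨3, hψnil c' hc'⟩ (hreg3 c hc h3) (hreg3 c' hc' (by omega))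
  have hsep : ∀ u ∈ S, ∀ u' ∈ S, b u < b u' → ∀ y ∈ P u', ConjClasses.mk y ≠ u := by
    intro u hu u' _ hlt y hy hyu
    -- `y ∼ out u`: `ψ y = k ψ(out u) k⁻¹` with `k ∈ U(σ_w, J₀)`
    obtain ⟨k, hk, hky⟩ := (hψconj (Quotient.out u) y).1 (by rw [hout u, hyu])
    -- `ψ y` when `u` is the class of `1` ∕ of `n(ϖδ)` ∕ of `n(δ)`
    have hy1 : b u = 0 → ψ y = 1 := fun h0 => by rw [← hky, (hb0 u).1 h0, mul_one, mul_inv_cancel]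
    have hyn₁ : b u = 1 → ∃ k₁ : GL (Fin 3) (w.1.adicCompletion L), k₁ ∈ unitaryGroupOfForm (galAdicCompletionMap (L := L) (IsCMField.complexConj L) hw) ((StdForm.antidiagonal 3).over (w.1.adicCompletion L)) ∧
        ψ y = k₁ * n₁ * k₁⁻¹ := fun h1 => by
      obtain ⟨k₁, hk₁, hk₁n⟩ := (hIsCj _ _).1 ((hb1 u).1 h1).2
      exact ⟨k * k₁⁻¹, mul_mem hk (inv_mem hk₁), by rw [← hky, ← hk₁n]; group⟩
    have hyn₀ : b u = 2 → ∃ k₀ : GL (Fin 3) (w.1.adicCompletion L), ψ y = k₀ * n₀ * k₀⁻¹ := fun h2 => by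
      obtain ⟨k₀, -, hk₀n⟩ := (hIsCj _ _).1 ((hb2 u).1 h2).2.2
      exact ⟨k * k₀⁻¹, by rw [← hky, ← hk₀n]; group⟩
    rw [hP u'] at hy
    have hcases : b u' = 1 ∨ b u' = 2 ∨ b u' = 3 := by have := hb_le u'; omega
    rcases hcases with h1 | h2 | h3
    · -- `P u' = K(d+1) ∖ K(d+2)` misses the class of `1`
      rw [if_neg (by omega), if_pos h1, Set.mem_setOf_eq] at hy
      exact hy.2.2 (hlev_one y _ (hy1 (by omega)))
    · -- `P u' = K(d) ∖ K(d+1)` misses the class of `1` and — THE PARITY ROW (★ FILE A) — the class of `n(ϖ^{d+1} δ)`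
      rw [if_neg (by omega), if_neg (by omega), if_pos h2, Set.mem_setOf_eq] at hy
      apply hy.2.2
      have hbu : b u = 0 ∨ b u = 1 := by omega
      rcases hbu with h0 | h1
      · exact hlev_one y _ (hy1 h0)
      · obtain ⟨k₁, hk₁, hψy⟩ := hyn₁ h1
        have hle := (hlev _ _).1 hy.2.1
        rw [hlev, hψy]
        rw [hψy] at hle
        exact forall_v_conj_cornerUnipotent_pow_succ_sub_one_apply_le (galAdicCompletionMap (L := L) (IsCMField.complexConj L) hw) hd hvδ d hn₁ hk₁ hle
    · -- `P u' = R` misses the classes of `1`, `n(ϖδ)`, `n(δ)` (all square-zero)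
      rw [if_neg (by omega), if_neg (by omega), if_neg (by omega), Set.mem_setOf_eq] at hy
      apply hy.2
      have hsq0 : (((ψ y : GL (Fin 3) (w.1.adicCompletion L)) : Matrix (Fin 3) (Fin 3) (w.1.adicCompletion L)) - 1) *
          (((ψ y : GL (Fin 3) (w.1.adicCompletion L)) : Matrix (Fin 3) (Fin 3) (w.1.adicCompletion L)) - 1) = 0 := by
        have hbu : b u = 0 ∨ b u = 1 ∨ b u = 2 := by omega
        rcases hbu with h0 | h1 | h2
        · rw [hy1 h0, Units.val_one, sub_self, Matrix.zero_mul]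
        · obtain ⟨k₁, -, hψy⟩ := hyn₁ h1
          rw [hψy]; exact conj_cornerUnipotent_sub_one_mul_self hn₁ _
        · obtain ⟨k₀, hψy⟩ := hyn₀ h2
          rw [hψy]; exact conj_cornerUnipotent_sub_one_mul_self hn₀ _
      rw [hsq1]
      intro a c
      rw [hsq0, Matrix.zero_apply, map_zero]; exact zero_le
  -- ## 5. Assembly
  refine ⟨fun u => (P u).indicator fun _ => (1 : ℂ), fun i => isLocSmooth_indicator (hPo i i.2) (hPcl i i.2) (hPc i i.2), fun i => ?_, fun i u hu x => ?_,
    fun i u hu x => ?_, det_classOrbitalIntegral_indicator_ne_zero S mU hmU hRao P hPo hPc hPcl hPx b hbinj hsep⟩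
  · -- support inside `K`
    exact hKcl.closure_subset_iff.2 (Set.support_indicator_subset.trans (hPK i))
  · -- `Ad K`-invariance
    show (P i).indicator (fun _ => (1 : ℂ)) (u * x * u⁻¹) = (P i).indicator (fun _ => (1 : ℂ)) x
    by_cases hx : x ∈ P i
    · rw [Set.indicator_of_mem hx, Set.indicator_of_mem ((hPconj i u hu x).2 hx)]
    · rw [Set.indicator_of_notMem hx, Set.indicator_of_notMem (fun h => hx ((hPconj i u hu x).1 h))]
  · -- left-invariance under the level-(d+2) congruence set
    have huK := mem_cmLocalIntegralLevel_of_levelToken L H' v w hw hT hv hTint (Nat.succ_le_succ (Nat.zero_le _)) hu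
    have hu2' : lev (-((d : ℤ) + 2)) u := (hlev _ u).2 (by
      rw [hψ]
      have h := (forall_levelToken_iff L H' v w hw hv hTint (d + 2) u).1 hu
      have hc : ((d + 2 : ℕ) : ℤ) = (d : ℤ) + 2 := by push_cast; ring
      rw [hc] at h
      exact h)
    show (P i).indicator (fun _ => (1 : ℂ)) (u * x) = (P i).indicator (fun _ => (1 : ℂ)) x
    by_cases hx : x ∈ P i
    · rw [Set.indicator_of_mem hx, Set.indicator_of_mem ((hPmul i u huK hu2' x).2 hx)]
    · rw [Set.indicator_of_notMem hx, Set.indicator_of_notMem (fun h => hx ((hPmul i u huK hu2' x).1 h))]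

end Literature.NumberTheory.Rogawski1990

end
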